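import Summits.Ventures.PercRepro.Night2ShapeOneGeom

/-!
# PercRepro — the seven-point shape (i): the CROSS-SIDE facts (night-2, gen 30)

The two lines share the outside points (proofs/NIGHT-2-g30.md §4 (c1)–(c4)); the two facts that couple the sides:
**`notMem_clF_face_of_mem_clF_base`**: an outside point of `H = cl (S ∖ w)` lying in the base `cl (S ∖ R₂)` of
side `2` (i.e. on the line `R₁`) is in NO face closure `cl (insert p (S ∖ R₁))` of side `1` (rank: `H ∩ cl (S ∖ R₂)`
has rank `3` and meets a face of side `1` in the rank-`2` flat `cl {e₀, p}`, which contains no outside point because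
`e₀` is a coloop of `G`); **`not_mem_clF_base_both`**: no outside point lies in both bases `cl (S ∖ R₁)`, `cl (S ∖ R₂)`
(their intersection has rank `≤ 2` and contains `{e₀, w}`).  Also `mem_clF_base_of_mem_two_faces_S`: an outside
point in two face closures of a side is in its base (rank `4`).  All by submodularity (`rkN_submod`).
-/

namespace PercRepro.Shadow

open Finset PerFlat ThmH

variable {α : Type*} [DecidableEq α] {M : Matroid α} [M.Finite] {G : Finset α}

section Cross

/-- The coloop of `G` is a coloop of every subset containing it. -/
theorem mem_coloops_of_subset {S : Finset α} (hSG : S ⊆ G) {e : α} (he : e ∈ coloops M G) (heS : e ∈ S) :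
    e ∈ coloops M S := by
  rw [mem_coloops] at he ⊢
  exact ⟨heS, fun h => he.2 (clF_mono (Finset.erase_subset_erase _ hSG) h)⟩

/-- **No outside point on a line through the coloop of `G`**: `x ∈ cl {e₀, p}` with `x ∈ G ∖ S`, `p ∈ S`, `e₀` the coloop
of `G` is impossible (then `e₀ ∈ cl {p, x} ⊆ cl (G ∖ e₀)`). -/
theorem not_mem_clF_pair_coloop (hG : G ∈ flatsQ M (5 + 1))
    (hs : ∀ e ∈ gr M, ∀ f ∈ gr M, e ≠ f → rkN M {e, f} = 2) {e₀ : α} (he₀ : e₀ ∈ coloops M G) {p x : α}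
    (hpG : p ∈ G) (hxG : x ∈ G) (hpe : p ≠ e₀) (hxe : x ≠ e₀) (hxp : x ≠ p) (hx : x ∈ clF M {e₀, p}) : False := by
  have hGg : G ⊆ gr M := (mem_flatsQ.1 hG).1
  have he₀G : e₀ ∈ G := (mem_coloops.1 he₀).1
  have hpair : rkN M ({p, x} : Finset α) = 2 := hs p (hGg hpG) x (hGg hxG) hxp.symm
  have hpair' : rkN M ({e₀, p} : Finset α) = 2 := hs e₀ (hGg he₀G) p (hGg hpG) hpe.symm
  -- `{e₀, p, x} ⊆ cl {e₀, p}` has rank `≤ 2`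
  have hpairg : ({e₀, p} : Finset α) ⊆ gr M := by
    intro a ha
    simp only [Finset.mem_insert, Finset.mem_singleton] at ha
    rcases ha with h | h
    · rw [h]; exact hGg he₀G
    · rw [h]; exact hGg hpG
  have hpxg : ({p, x} : Finset α) ⊆ gr M := by
    intro a ha
    simp only [Finset.mem_insert, Finset.mem_singleton] at ha
    rcases ha with h | h
    · rw [h]; exact hGg hpG
    · rw [h]; exact hGg hxG
  have hsub : ({e₀, p, x} : Finset α) ⊆ clF M {e₀, p} :=
    Finset.insert_subset (subset_clF_of_subset_gr hpairg (Finset.mem_insert_self _ _))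
      (Finset.insert_subset (subset_clF_of_subset_gr hpairg (Finset.mem_insert_of_mem (Finset.mem_singleton_self _)))
        (Finset.singleton_subset_iff.2 hx))
  have h3 : rkN M ({e₀, p, x} : Finset α) ≤ 2 := by
    have := rkN_mono (M := M) hsub
    rw [rkN_clF, hpair'] at this
    exact this
  -- so `e₀ ∈ cl {p, x}`
  have hsub2 : ({p, x} : Finset α) ⊆ ({e₀, p, x} : Finset α) := Finset.subset_insert _ _
  have hall : ({e₀, p, x} : Finset α) ⊆ gr M := Finset.insert_subset (hGg he₀G) hpxg
  have hr : rkN M ({p, x} : Finset α) = rkN M ({e₀, p, x} : Finset α) := by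
    have := rkN_mono (M := M) hsub2
    omega
  have he₀cl : e₀ ∈ clF M ({p, x} : Finset α) := mem_clF_of_rkN_eq hsub2 hall hr (Finset.mem_insert_self _ _)
  -- contradiction with the coloop
  have hsub3 : ({p, x} : Finset α) ⊆ G.erase e₀ := by
    intro a ha
    simp only [Finset.mem_insert, Finset.mem_singleton] at ha
    rcases ha with h | h
    · rw [h]; exact Finset.mem_erase.2 ⟨hpe, hpG⟩
    · rw [h]; exact Finset.mem_erase.2 ⟨hxe, hxG⟩
  exact (mem_coloops.1 he₀).2 (clF_mono hsub3 he₀cl)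

/-- `x ∈ cl {e₀, p}` from `rk {e₀, p, x} ≤ 2` (`e₀ ≠ p`, in `G`). -/
theorem mem_clF_pair_of_rkN_le_two (hG : G ∈ flatsQ M (5 + 1))
    (hs : ∀ e ∈ gr M, ∀ f ∈ gr M, e ≠ f → rkN M {e, f} = 2) {e₀ p x : α} (he₀ : e₀ ∈ G) (hp : p ∈ G) (hx : x ∈ G)
    (hpe : p ≠ e₀) (h : rkN M ({e₀, p, x} : Finset α) ≤ 2) : x ∈ clF M {e₀, p} := by
  have hGg : G ⊆ gr M := (mem_flatsQ.1 hG).1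
  have hpair : rkN M ({e₀, p} : Finset α) = 2 := hs e₀ (hGg he₀) p (hGg hp) hpe.symm
  have hsub : ({e₀, p} : Finset α) ⊆ ({e₀, p, x} : Finset α) := by
    intro a ha; simp only [Finset.mem_insert, Finset.mem_singleton] at ha ⊢; tauto
  have hall : ({e₀, p, x} : Finset α) ⊆ gr M := by
    intro a ha; simp only [Finset.mem_insert, Finset.mem_singleton] at ha
    rcases ha with h | h | h <;> rw [h]
    · exact hGg he₀
    · exact hGg hp
    · exact hGg hx
  have hr : rkN M ({e₀, p} : Finset α) = rkN M ({e₀, p, x} : Finset α) := by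
    have := rkN_mono (M := M) hsub
    omega
  exact mem_clF_of_rkN_eq hsub hall hr (by simp)

/-- Submodularity for two closures: `rk (cl X ∩ cl Y) + rk (X ∪ Y) ≤ rk X + rk Y`. -/
theorem rkN_inter_clF_add_le {X Y : Finset α} (hX : X ⊆ gr M) (hY : Y ⊆ gr M) :
    rkN M (clF M X ∩ clF M Y) + rkN M (X ∪ Y) ≤ rkN M X + rkN M Y := by
  have h := rkN_submod (M := M) (clF M X) (clF M Y)
  rw [rkN_clF, rkN_clF] at h
  have h2 : rkN M (X ∪ Y) ≤ rkN M (clF M X ∪ clF M Y) :=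
    rkN_mono (Finset.union_subset_union (subset_clF_of_subset_gr hX) (subset_clF_of_subset_gr hY))
  omega

section Ranks

variable (hG : G ∈ flatsQ M (5 + 1)) (hk : kColoops M G = 1)
  (hs : ∀ e ∈ gr M, ∀ f ∈ gr M, e ≠ f → rkN M {e, f} = 2) {S : Finset α} (hSG : S ⊆ G) (hKS : coloops M G ⊆ S)
  (hV5 : rkN M (S \ coloops M G) = 5)

include hG hk hSG hKS hV5 in
/-- `rk S = 6`: the coloop of `G` adds one to `rk (S ∖ K) = 5`. -/
theorem rkN_S_eq_six : rkN M S = 6 := by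
  have hGg : G ⊆ gr M := (mem_flatsQ.1 hG).1
  have hT : coloops M G ⊆ coloops M S := fun e he => mem_coloops_of_subset hSG he (hKS he)
  have h := rkN_sdiff_add_card_of_subset_coloops (M := M) (hSG.trans hGg) hT
  rw [hV5, ← kColoops_eq_card_coloops, hk] at h
  omega

include hG hk hSG in
/-- The rank of a subset of `S` containing `K`: `rk X = rk (X ∖ K) + 1`. -/
theorem rkN_eq_rkN_sdiff_add_one {X : Finset α} (hXS : X ⊆ S) (hKX : coloops M G ⊆ X) :
    rkN M X = rkN M (X \ coloops M G) + 1 := by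
  have hGg : G ⊆ gr M := (mem_flatsQ.1 hG).1
  have hT : coloops M G ⊆ coloops M X := fun e he => mem_coloops_of_subset (hXS.trans hSG) he (hKX he)
  have h := rkN_sdiff_add_card_of_subset_coloops (M := M) (hXS.trans (hSG.trans hGg)) hT
  rw [← kColoops_eq_card_coloops, hk] at h
  omega

end Ranks

/-- An outside point of `G` (off `S`, hence not the coloop) on the line through the coloop and a point of `S`:
impossible. -/
theorem not_mem_clF_pair_coloop' (hG : G ∈ flatsQ M (5 + 1))
    (hs : ∀ e ∈ gr M, ∀ f ∈ gr M, e ≠ f → rkN M {e, f} = 2) {S : Finset α} (hSG : S ⊆ G)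
    (hKS : coloops M G ⊆ S) {e₀ : α} (he₀ : e₀ ∈ coloops M G) {p x : α} (hpS : p ∈ S) (hpe : p ≠ e₀)
    (hx : x ∈ G \ S) (hxcl : x ∈ clF M {e₀, p}) : False := by
  have hxG : x ∈ G := (Finset.mem_sdiff.1 hx).1
  have hxS : x ∉ S := (Finset.mem_sdiff.1 hx).2
  exact not_mem_clF_pair_coloop hG hs he₀ (hSG hpS) hxG hpe (fun h => hxS (h ▸ hKS he₀)) (fun h => hxS (h ▸ hpS)) hxcl

section Bases

variable (hG : G ∈ flatsQ M (5 + 1)) (hk : kColoops M G = 1)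
  (hs : ∀ e ∈ gr M, ∀ f ∈ gr M, e ≠ f → rkN M {e, f} = 2) {S : Finset α} (hSG : S ⊆ G) (hKS : coloops M G ⊆ S)
  (hV5 : rkN M (S \ coloops M G) = 5) {w : α} (hc : coloops M (S \ coloops M G) = {w})

include hG hk hSG hKS hV5 hc in
/-- `rk (S ∖ w) = 5`. -/
theorem rkN_erase_coloop_eq_five : rkN M (S.erase w) = 5 := by
  have hGg : G ⊆ gr M := (mem_flatsQ.1 hG).1
  have hwc : w ∈ coloops M (S \ coloops M G) := by rw [hc]; exact Finset.mem_singleton_self _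
  have hwV : w ∈ S \ coloops M G := (mem_coloops.1 hwc).1
  have hwK : w ∉ coloops M G := (Finset.mem_sdiff.1 hwV).2
  have hKS' : coloops M G ⊆ S.erase w := fun e he => Finset.mem_erase.2 ⟨fun h => hwK (h ▸ he), hKS he⟩
  have h1 := rkN_eq_rkN_sdiff_add_one hG hk hSG (X := S.erase w) (Finset.erase_subset _ _) hKS'
  have h2 : (S.erase w) \ coloops M G = (S \ coloops M G).erase w := by
    ext a; simp only [Finset.mem_sdiff, Finset.mem_erase]; tauto
  have h3 := rkN_sdiff_add_card_of_subset_coloops (M := M) (Y := S \ coloops M G)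
    (Finset.sdiff_subset.trans (hSG.trans hGg)) (T := {w}) (by rw [hc])
  rw [Finset.card_singleton, hV5, Finset.sdiff_singleton_eq_erase] at h3
  rw [h1, h2]
  omega

include hG hk hSG hKS hc in
/-- **The base of a side has rank `4`**: `rk (S ∖ R) = 4` for a collinear triple `R ⊆ S ∖ K` not containing `w`,
when `S ∖ K = {w} ∪ R ∪ R′` — the base is `K ∪ {w} ∪ R′` with `R′` the other line. -/
theorem rkN_base_eq_four {R R' : Finset α} (hR : R ⊆ S \ coloops M G) (hR' : R' ⊆ S \ coloops M G)
    (hr' : rkN M R' = 2) (hV : S \ coloops M G = insert w (R ∪ R')) (hwR : w ∉ R)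
    (hwR' : w ∉ R') (hdis : Disjoint R R') : rkN M (S \ R) = 4 := by
  have hGg : G ⊆ gr M := (mem_flatsQ.1 hG).1
  have hwc : w ∈ coloops M (S \ coloops M G) := by rw [hc]; exact Finset.mem_singleton_self _
  have hwV : w ∈ S \ coloops M G := (mem_coloops.1 hwc).1
  have hwS : w ∈ S := (Finset.mem_sdiff.1 hwV).1
  have hRV : ∀ a ∈ R, a ∉ coloops M G := fun a ha => (Finset.mem_sdiff.1 (hR ha)).2
  have hKS' : coloops M G ⊆ S \ R := fun e he => Finset.mem_sdiff.2 ⟨hKS he, fun h => hRV e h he⟩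
  have h1 := rkN_eq_rkN_sdiff_add_one hG hk hSG (X := S \ R) Finset.sdiff_subset hKS'
  -- `(S ∖ R) ∖ K = {w} ∪ R′`
  have h2 : (S \ R) \ coloops M G = insert w R' := by
    ext a
    simp only [Finset.mem_sdiff, Finset.mem_insert]
    constructor
    · rintro ⟨⟨haS, haR⟩, haK⟩
      have : a ∈ S \ coloops M G := Finset.mem_sdiff.2 ⟨haS, haK⟩
      rw [hV, Finset.mem_insert, Finset.mem_union] at this
      tauto
    · rintro (rfl | ha)
      · exact ⟨⟨hwS, hwR⟩, (Finset.mem_sdiff.1 hwV).2⟩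
      · have haV := hR' ha
        exact ⟨⟨(Finset.mem_sdiff.1 haV).1, fun h => Finset.disjoint_left.1 hdis h ha⟩, (Finset.mem_sdiff.1 haV).2⟩
  -- `w ∉ cl R′` (`R′ ⊆ S ∖ w` and `w ∉ cl (S ∖ w)`)
  have hwcl : w ∉ clF M R' := by
    intro h
    have hsub : R' ⊆ S.erase w := fun a ha => Finset.mem_erase.2 ⟨fun h' => hwR' (h' ▸ ha), (Finset.mem_sdiff.1 (hR' ha)).1⟩
    exact coloop_notMem_clF_erase hG hk hSG hKS hwc (clF_mono hsub h)
  have h3 : rkN M (insert w R') = 3 := by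
    rw [rkN_insert_of_notMem_clF (hGg (hSG hwS)) hwcl, hr']
  rw [h1, h2, h3]

end Bases

section CrossFacts

variable (hG : G ∈ flatsQ M (5 + 1)) (hk : kColoops M G = 1)
  (hs : ∀ e ∈ gr M, ∀ f ∈ gr M, e ≠ f → rkN M {e, f} = 2) {S : Finset α} (hSG : S ⊆ G) (hKS : coloops M G ⊆ S)
  (hV5 : rkN M (S \ coloops M G) = 5) {w : α} (hc : coloops M (S \ coloops M G) = {w})
  {R₁ R₂ : Finset α} (hR₁ : R₁ ⊆ S \ coloops M G) (hR₂ : R₂ ⊆ S \ coloops M G) (h₁ : R₁.card = 3) (h₂ : R₂.card = 3)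
  (hr₁ : rkN M R₁ = 2) (hr₂ : rkN M R₂ = 2) (hdis : Disjoint R₁ R₂) (hV : S \ coloops M G = insert w (R₁ ∪ R₂))
  (hw₁ : w ∉ R₁) (hw₂ : w ∉ R₂)

include hG hk hs hSG hKS hV5 hc hR₁ hR₂ hr₁ hr₂ hdis hV hw₁ hw₂ in
/-- **(G3) No outside point lies in both bases** `cl (S ∖ R₁)`, `cl (S ∖ R₂)`: their intersection has rank `≤ 2` and
contains `{e₀, w}`. -/
theorem not_mem_both_bases {x : α} (hx : x ∈ G \ S) (hx₁ : x ∈ clF M (S \ R₁)) (hx₂ : x ∈ clF M (S \ R₂)) : False := by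
  have hGg : G ⊆ gr M := (mem_flatsQ.1 hG).1
  have hSg : S ⊆ gr M := hSG.trans hGg
  obtain ⟨e₀, he₀⟩ := Finset.card_eq_one.1 (show (coloops M G).card = 1 by rw [← kColoops_eq_card_coloops]; exact hk)
  have he₀K : e₀ ∈ coloops M G := by rw [he₀]; exact Finset.mem_singleton_self _
  have he₀S : e₀ ∈ S := hKS he₀K
  have hwc : w ∈ coloops M (S \ coloops M G) := by rw [hc]; exact Finset.mem_singleton_self _
  have hwV : w ∈ S \ coloops M G := (mem_coloops.1 hwc).1
  have hwS : w ∈ S := (Finset.mem_sdiff.1 hwV).1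
  have hwe : w ≠ e₀ := fun h => (Finset.mem_sdiff.1 hwV).2 (h ▸ he₀K)
  have hb₁ := rkN_base_eq_four hG hk hSG hKS hc hR₁ hR₂ hr₂ hV hw₁ hw₂ hdis
  have hb₂ := rkN_base_eq_four hG hk hSG hKS hc hR₂ hR₁ hr₁ (by rw [hV, Finset.union_comm]) hw₂ hw₁ hdis.symm
  have hS6 := rkN_S_eq_six hG hk hSG hKS hV5
  have hunion : (S \ R₁) ∪ (S \ R₂) = S := by
    ext a
    simp only [Finset.mem_union, Finset.mem_sdiff]
    constructor
    · rintro (h | h) <;> exact h.1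
    · intro ha
      by_cases h1 : a ∈ R₁
      · exact Or.inr ⟨ha, Finset.disjoint_left.1 hdis h1⟩
      · exact Or.inl ⟨ha, h1⟩
  have hsub := rkN_inter_clF_add_le (M := M) (X := S \ R₁) (Y := S \ R₂) (Finset.sdiff_subset.trans hSg)
    (Finset.sdiff_subset.trans hSg)
  rw [hunion, hS6, hb₁, hb₂] at hsub
  -- `{e₀, w, x}` lies in the intersection
  have hmem : ({e₀, w, x} : Finset α) ⊆ clF M (S \ R₁) ∩ clF M (S \ R₂) := by
    have he₀₁ : e₀ ∈ S \ R₁ := Finset.mem_sdiff.2 ⟨he₀S, fun h => (Finset.mem_sdiff.1 (hR₁ h)).2 he₀K⟩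
    have he₀₂ : e₀ ∈ S \ R₂ := Finset.mem_sdiff.2 ⟨he₀S, fun h => (Finset.mem_sdiff.1 (hR₂ h)).2 he₀K⟩
    have hw₁' : w ∈ S \ R₁ := Finset.mem_sdiff.2 ⟨hwS, hw₁⟩
    have hw₂' : w ∈ S \ R₂ := Finset.mem_sdiff.2 ⟨hwS, hw₂⟩
    intro a ha
    simp only [Finset.mem_insert, Finset.mem_singleton] at ha
    rw [Finset.mem_inter]
    rcases ha with h | h | h <;> rw [h]
    · exact ⟨subset_clF_of_subset_gr (Finset.sdiff_subset.trans hSg) he₀₁, subset_clF_of_subset_gr (Finset.sdiff_subset.trans hSg) he₀₂⟩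
    · exact ⟨subset_clF_of_subset_gr (Finset.sdiff_subset.trans hSg) hw₁', subset_clF_of_subset_gr (Finset.sdiff_subset.trans hSg) hw₂'⟩
    · exact ⟨hx₁, hx₂⟩
  have h3 : rkN M ({e₀, w, x} : Finset α) ≤ 2 := by
    have := rkN_mono (M := M) hmem
    omega
  have hxcl := mem_clF_pair_of_rkN_le_two hG hs (hSG he₀S) (hSG hwS) (Finset.mem_sdiff.1 hx).1 hwe h3
  exact not_mem_clF_pair_coloop' hG hs hSG hKS he₀K hwS hwe hx hxcl

include hG hk hs hSG hKS hV5 hc hR₁ hR₂ hr₁ hr₂ hdis hV hw₁ hw₂ in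
/-- **(G1) An outside point of `H` in the base of side `2` is in no face closure of side `1`**: `x ∈ cl (S ∖ w) ∩
cl (S ∖ R₂)` lies in `cl (K ∪ R₁)` (rank `3`), which meets `cl (insert p (S ∖ R₁))` in the line `cl {e₀, p}`. -/
theorem not_mem_face_of_mem_H_base {x : α} (hx : x ∈ G \ S) (hxH : x ∈ clF M (S.erase w))
    (hx₂ : x ∈ clF M (S \ R₂)) {p : α} (hp : p ∈ R₁) (hxp : x ∈ clF M (insert p (S \ R₁))) : False := by
  have hGg : G ⊆ gr M := (mem_flatsQ.1 hG).1
  have hSg : S ⊆ gr M := hSG.trans hGg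
  obtain ⟨e₀, he₀⟩ := Finset.card_eq_one.1 (show (coloops M G).card = 1 by rw [← kColoops_eq_card_coloops]; exact hk)
  have he₀K : e₀ ∈ coloops M G := by rw [he₀]; exact Finset.mem_singleton_self _
  have he₀S : e₀ ∈ S := hKS he₀K
  have hwc : w ∈ coloops M (S \ coloops M G) := by rw [hc]; exact Finset.mem_singleton_self _
  have hwV : w ∈ S \ coloops M G := (mem_coloops.1 hwc).1
  have hwS : w ∈ S := (Finset.mem_sdiff.1 hwV).1
  have hpV := hR₁ hp
  have hpS : p ∈ S := (Finset.mem_sdiff.1 hpV).1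
  have hpe : p ≠ e₀ := fun h => (Finset.mem_sdiff.1 hpV).2 (h ▸ he₀K)
  have hR₁S : R₁ ⊆ S := fun a ha => (Finset.mem_sdiff.1 (hR₁ ha)).1
  have hR₁g : R₁ ⊆ gr M := hR₁S.trans hSg
  have hS6 := rkN_S_eq_six hG hk hSG hKS hV5
  have hH5 := rkN_erase_coloop_eq_five hG hk hSG hKS hV5 hc
  have hb₂ := rkN_base_eq_four hG hk hSG hKS hc hR₂ hR₁ hr₁ (by rw [hV, Finset.union_comm]) hw₂ hw₁ hdis.symm
  have hb₁ := rkN_base_eq_four hG hk hSG hKS hc hR₁ hR₂ hr₂ hV hw₁ hw₂ hdis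
  -- STEP 1: `x ∈ cl (insert e₀ R₁)`
  have he₀R : e₀ ∉ clF M R₁ := by
    intro h
    have hsub : R₁ ⊆ G.erase e₀ := fun a ha => Finset.mem_erase.2 ⟨fun h' => (Finset.mem_sdiff.1 (hR₁ ha)).2 (h' ▸ he₀K), hSG (hR₁S ha)⟩
    exact (mem_coloops.1 he₀K).2 (clF_mono hsub h)
  have hr₁' : rkN M (insert e₀ R₁) = 3 := by rw [rkN_insert_of_notMem_clF (hGg (hSG he₀S)) he₀R, hr₁]
  have hunion₁ : (S.erase w) ∪ (S \ R₂) = S := by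
    ext a
    simp only [Finset.mem_union, Finset.mem_erase, Finset.mem_sdiff]
    constructor
    · rintro (h | h)
      · exact h.2
      · exact h.1
    · intro ha
      by_cases haw : a = w
      · exact Or.inr ⟨ha, fun h => hw₂ (haw ▸ h)⟩
      · exact Or.inl ⟨haw, ha⟩
  have hsub₁ := rkN_inter_clF_add_le (M := M) (X := S.erase w) (Y := S \ R₂) ((Finset.erase_subset _ _).trans hSg)
    (Finset.sdiff_subset.trans hSg)
  rw [hunion₁, hS6, hH5, hb₂] at hsub₁
  have hmem₁ : insert x (insert e₀ R₁) ⊆ clF M (S.erase w) ∩ clF M (S \ R₂) := by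
    intro a ha
    rw [Finset.mem_inter]
    rw [Finset.mem_insert, Finset.mem_insert] at ha
    rcases ha with h | h | h
    · rw [h]; exact ⟨hxH, hx₂⟩
    · rw [h]
      refine ⟨subset_clF_of_subset_gr ((Finset.erase_subset _ _).trans hSg) (Finset.mem_erase.2 ⟨fun h' => ?_, he₀S⟩),
        subset_clF_of_subset_gr (Finset.sdiff_subset.trans hSg) (Finset.mem_sdiff.2 ⟨he₀S, fun h' => (Finset.mem_sdiff.1 (hR₂ h')).2 he₀K⟩)⟩
      exact (Finset.mem_sdiff.1 hwV).2 (h' ▸ he₀K)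
    · refine ⟨subset_clF_of_subset_gr ((Finset.erase_subset _ _).trans hSg) (Finset.mem_erase.2 ⟨fun h' => hw₁ (h' ▸ h), hR₁S h⟩),
        subset_clF_of_subset_gr (Finset.sdiff_subset.trans hSg) (Finset.mem_sdiff.2 ⟨hR₁S h, Finset.disjoint_left.1 hdis h⟩)⟩
  have hle₁ : rkN M (insert x (insert e₀ R₁)) ≤ 3 := by
    have := rkN_mono (M := M) hmem₁
    omega
  have hxcl₁ : x ∈ clF M (insert e₀ R₁) := by
    apply mem_clF_of_rkN_eq (Finset.subset_insert _ _) (Finset.insert_subset (hGg (Finset.mem_sdiff.1 hx).1)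
      (Finset.insert_subset (hGg (hSG he₀S)) hR₁g)) _ (Finset.mem_insert_self _ _)
    have := rkN_mono (M := M) (Finset.subset_insert x (insert e₀ R₁))
    omega
  -- STEP 2: `x ∈ cl {e₀, p}`
  have hface : rkN M (insert p (S \ R₁)) ≤ 5 := by
    have := rkN_union_le_rkN_add_card (M := M) (S \ R₁) {p}
    rw [Finset.card_singleton, hb₁] at this
    rw [Finset.insert_eq, Finset.union_comm]
    exact this
  have hunion₂ : (insert e₀ R₁) ∪ insert p (S \ R₁) = S := by
    ext a
    simp only [Finset.mem_union, Finset.mem_insert, Finset.mem_sdiff]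
    constructor
    · rintro ((h | h) | (h | h))
      · rw [h]; exact he₀S
      · exact hR₁S h
      · rw [h]; exact hpS
      · exact h.1
    · intro ha
      by_cases h1 : a ∈ R₁
      · exact Or.inl (Or.inr h1)
      · exact Or.inr (Or.inr ⟨ha, h1⟩)
  have hsub₂ := rkN_inter_clF_add_le (M := M) (X := insert e₀ R₁) (Y := insert p (S \ R₁))
    (Finset.insert_subset (hGg (hSG he₀S)) hR₁g) (Finset.insert_subset (hGg (hSG hpS)) (Finset.sdiff_subset.trans hSg))
  rw [hunion₂, hS6, hr₁'] at hsub₂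
  have hmem₂ : ({e₀, p, x} : Finset α) ⊆ clF M (insert e₀ R₁) ∩ clF M (insert p (S \ R₁)) := by
    have hg₁ : insert e₀ R₁ ⊆ gr M := Finset.insert_subset (hGg (hSG he₀S)) hR₁g
    have hg₂ : insert p (S \ R₁) ⊆ gr M := Finset.insert_subset (hGg (hSG hpS)) (Finset.sdiff_subset.trans hSg)
    intro a ha
    rw [Finset.mem_inter]
    simp only [Finset.mem_insert, Finset.mem_singleton] at ha
    rcases ha with h | h | h <;> rw [h]
    · exact ⟨subset_clF_of_subset_gr hg₁ (Finset.mem_insert_self _ _),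
        subset_clF_of_subset_gr hg₂ (Finset.mem_insert_of_mem (Finset.mem_sdiff.2 ⟨he₀S, fun h' => (Finset.mem_sdiff.1 (hR₁ h')).2 he₀K⟩))⟩
    · exact ⟨subset_clF_of_subset_gr hg₁ (Finset.mem_insert_of_mem hp), subset_clF_of_subset_gr hg₂ (Finset.mem_insert_self _ _)⟩
    · exact ⟨hxcl₁, hxp⟩
  have h3 : rkN M ({e₀, p, x} : Finset α) ≤ 2 := by
    have := rkN_mono (M := M) hmem₂
    omega
  have hxcl := mem_clF_pair_of_rkN_le_two hG hs (hSG he₀S) (hSG hpS) (Finset.mem_sdiff.1 hx).1 hpe h3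
  exact not_mem_clF_pair_coloop' hG hs hSG hKS he₀K hpS hpe hx hxcl

end CrossFacts

end Cross

end PercRepro.Shadow
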